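import Summits.ResolutionOfSingularities.ResolutionOfSingularities.Theorems.PurelyInseparableDim4WideSuccessorRidge
import Summits.ResolutionOfSingularities.ResolutionOfSingularities.Theorems.PurelyInseparableDim4ExceptionalStaircase
import Summits.ResolutionOfSingularities.ResolutionOfSingularities.Theorems.PurelyInseparableDim4JetOrderStaircase
import HarnessLib

/-!
# [OURS · res-dim4-pi] (NT) CLOSED IN THE FRAME — non-tangent moves from an intrinsic finite-level
  tangency test: a relation `g ∈ J_p⁺(F) + 𝔪₀ᴹ` of order `≥ o` whose degree-`o` part does not vanish at
  the direction `w = e_j + b` pulls back to `x_j^o · unit`; hence (NT)(i) `ē` drops when `o = 2`, and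
  (NT)(ii) the successor's order letter is `≤ o − 1`

Cell `res-dim4-pi` (D-0157 DOOR 2), seat `res-dim4-p-3` (g2); sixth file of the wide-core letter kit.
idea-3's CARD I-3-11 law (NT) (memo `iso6/WIDE-STRUCTURE.md` §4; crit-1 V-A-27: K on 24 568 edges) reads
«on a NON-TANGENT edge from a wide isolated floor state, some `g ∈ I_F` of order `o` has `g_o(w̄) ≠ 0`,
so `g∘σ = x_j^o·(unit)` and Kollár's containment gives `x_j^{o−1} ∈ Ĵ⁺(F′)`».  p-5 g2 typed the second
half with the pullback shape as HYPOTHESES (`hσ : aeval σ g = X j ^ o * h`, `hh : constantCoeff h ≠ 0`: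
`ExceptionalLength.X_pow_pred_mem_of_aeval_eq_mul_unit` p662098, `WideSuccessorRidge.ebar_step_lt_of_aeval_eq_X_sq_mul`
p662566).  This file manufactures (`hσ`, `hh`) from the intrinsic datum: for ANY `g` all of whose
monomials have degree `≥ o`, `aeval σ_{j,b} g = x_j^o · h` with
`constantCoeff h = eval (b with b_j := 1) (homogeneousComponent o g)` — the degree-`o` part of `g` at the
direction of the move.  So «non-tangent» := «some plane relation of order `o` is non-zero at the
direction» is a finite-level, decidable test, and (NT)(i)/(ii) become closed frame theorems.

* §1 `aeval_chart_eq_X_pow_mul` (the factorisation, explicit quotient), `constantCoeff_chartQuotient`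
  (its constant term = the degree-`o` part at the direction), `support_degree_le_of_mem_originIdeal_pow`.
* §2 `linearIndependent_pair_of_apply`, `exists_separating_snd_of_finrank_inf_le_one`
  (`dim (W ∩ {u_j = 0}) ≤ 1 ⇒` some pair `(j, b′)` separates `W`),
  `exists_originIdeal_le_span_pair_sup_step` (every successor of an `ē ≤ 2` floor state is planar in a
  pair containing the chart coordinate `x_j`; p-5 g2's `finrank_additiveSubspace_step_inf_add_one_le`).
* §3 THE LAWS: **`ebar_step_lt_of_eval_ne_zero`** ((NT)(i): `o = 2`), **`jetColength_step_lt_triangle_of_eval_ne_zero`**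
  ((NT)(ii): `d_k(s⁺) < k(k+1)/2` for all `k ≥ o`, i.e. `o(s⁺) ≤ o − 1`), and the corollary
  **`ebar_step_lt_of_isCert_two`** (a state certified at level `2` — `μ⁺ = d₂`, e.g. a wide state with
  `μ⁺ = 3` — loses ridge dimension at EVERY move: every state of an `E2` chain has `μ⁺ ≥ 4`).

[OURS · counted 0 · elementary algebra over the frame; AI kernel work, weaker than expert review.]  Nothing
here is a statement about resolution of singularities; nothing here proves `NoWideTrap` / `E2(3,3)`;
resolution in dimension `≥ 4` / characteristic `p > 0` is NOT proved by anything in this file.  Host item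
(DR-157-C): `stmt-ResolutionOfSingularities-16155`, helper.
-/

noncomputable section

set_option linter.dupNamespace false -- mandated namespace of this single-conjunct summit

open MvPolynomial Finset
open scoped BigOperators

namespace Summit.ResolutionOfSingularities.ResolutionOfSingularities.Theorems.PIDim4.RidgeBudget

open IsolationCert
open Literature.AlgebraicGeometry
open Literature.AlgebraicGeometry.Resolution
open Literature.AlgebraicGeometry.Resolution.Hauser2010
open Literature.AlgebraicGeometry.Resolution.HauserPerlega2019
open Literature.Barriers.ResolutionOfSingularities
open PointBlowup (direction gradSpan additiveSubspace boundarySubspace)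

variable {K : Type} [Field K]

/-! ## §1 The chart pullback of a relation of order `≥ o`: `x_j^o ·` (explicit quotient) -/

/-- Elements of `𝔪₀^o` have all monomials of degree `≥ o`. OURS (bookkeeping).
[cite: AtiyahMacdonald1969, Ch. 1 Ex. 1.1 (the ideal (x₁,…,xₙ))] -/
theorem support_degree_le_of_mem_originIdeal_pow {g : MvPolynomial (Fin 4) K} {o : ℕ}
    (hg : g ∈ originIdeal K ^ o) : ∀ A ∈ g.support, o ≤ A.degree := by
  intro A hA
  by_contra hlt
  exact (mem_support_iff.mp hA) ((mem_originIdeal_pow_iff o g).mp hg A (not_le.mp hlt))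

/-- **The factorisation.** If every monomial of `g` has degree `≥ o`, then under the chart map
`σ_{j,b}` (`x_j ↦ x_j`, `x_i ↦ x_j (x_i + b_i)`): `σ(g) = x_j^o · h` with the explicit quotient
`h = Σ_A coeff_A(g) · x_j^{|A|−o} · ∏_{c ≠ j} (x_c + b_c)^{A_c}`. OURS (computation over
`ExceptionalStaircase.aeval_chart_monomial`). [cite: Hauser2010, §F (chart expressions of a point blowup)] -/
theorem aeval_chart_eq_X_pow_mul {g : MvPolynomial (Fin 4) K} {o : ℕ} (j : Fin 4) (b : Fin 4 → K)
    (hg : ∀ A ∈ g.support, o ≤ A.degree) :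
    aeval (fun i => if i = j then (X j : MvPolynomial (Fin 4) K) else X j * (X i + C (b i))) g =
      X j ^ o * ∑ A ∈ g.support, C (coeff A g) *
        ((X j : MvPolynomial (Fin 4) K) ^ (A.degree - o) *
          ∏ c ∈ Finset.univ.erase j, (X c + C (b c)) ^ A c) := by
  classical
  conv_lhs => rw [g.as_sum, map_sum]
  rw [Finset.mul_sum]
  refine Finset.sum_congr rfl fun A hA => ?_
  rw [show monomial A (coeff A g) = C (coeff A g) * monomial A 1 by
      rw [C_mul_monomial, mul_one], map_mul, aeval_C, algebraMap_eq,
    ExceptionalLength.aeval_chart_monomial j b A]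
  have hdeg : A.degree = o + (A.degree - o) := (Nat.add_sub_cancel' (hg A hA)).symm
  conv_lhs => rw [hdeg, pow_add]
  ring

/-- **The constant term of the quotient is the degree-`o` part of `g` at the direction** `w = e_j + b`
(`w_i = b_i` for `i ≠ j`, `w_j = 1`): `constantCoeff h = eval w (homogeneousComponent o g)`.  So `h` is a
unit at the origin iff the order-`o` part of the relation does not vanish at the direction of the move —
idea-3's NON-TANGENCY, intrinsic and decidable. OURS (computation).
[cite: Hauser2010, §F (chart expressions of a point blowup)] -/
theorem constantCoeff_chartQuotient {g : MvPolynomial (Fin 4) K} {o : ℕ} (j : Fin 4) (b : Fin 4 → K)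
    (hg : ∀ A ∈ g.support, o ≤ A.degree) :
    constantCoeff (∑ A ∈ g.support, C (coeff A g) *
        ((X j : MvPolynomial (Fin 4) K) ^ (A.degree - o) *
          ∏ c ∈ Finset.univ.erase j, (X c + C (b c)) ^ A c)) =
      eval (Function.update b j 1) (homogeneousComponent o g) := by
  classical
  rw [homogeneousComponent_apply, map_sum, map_sum]
  rw [Finset.sum_filter]
  refine Finset.sum_congr rfl fun A hA => ?_
  simp only [map_mul, constantCoeff_C, map_pow, map_prod, map_add, constantCoeff_X, zero_add]
  by_cases hAo : A.degree = o
  · rw [if_pos hAo, hAo, Nat.sub_self, pow_zero, one_mul, eval_monomial,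
      Finsupp.prod_fintype _ _ (fun i => pow_zero _),
      ← Finset.mul_prod_erase Finset.univ _ (Finset.mem_univ j), Function.update_self, one_pow,
      one_mul]
    congr 1
    exact Finset.prod_congr rfl fun c hc => by
      rw [Function.update_of_ne (Finset.ne_of_mem_erase hc)]
  · have hpos : 0 < A.degree - o := by
      have := hg A hA
      omega
    rw [if_neg hAo, zero_pow hpos.ne', zero_mul, mul_zero]

/-! ## §2 A successor of an `ē ≤ 2` state is planar in a pair containing the chart coordinate -/

/-- Two vectors of `W` with `v_b ≠ 0`, `u_b = 0`, `u ≠ 0` are independent. OURS (linear algebra). [folklore] -/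
theorem linearIndependent_pair_of_apply {W : Submodule K (Fin 4 → K)} {v u : Fin 4 → K}
    (hv : v ∈ W) (hu : u ∈ W) {b : Fin 4} (hvb : v b ≠ 0) (hub : u b = 0) (hu0 : u ≠ 0) :
    LinearIndependent K (![⟨v, hv⟩, ⟨u, hu⟩] : Fin 2 → W) := by
  rw [Fintype.linearIndependent_iff]
  intro g hg
  rw [Fin.sum_univ_two] at hg
  simp only [Matrix.cons_val_zero, Matrix.cons_val_one] at hg
  have hg' := congrArg (fun x : W => (x : Fin 4 → K)) hg
  simp only [Submodule.coe_add, Submodule.coe_smul_of_tower, Submodule.coe_zero] at hg'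
  have hb := congrFun hg' b
  simp only [Pi.add_apply, Pi.smul_apply, smul_eq_mul, Pi.zero_apply, hub, mul_zero, add_zero] at hb
  have h0 : g 0 = 0 := (mul_eq_zero.mp hb).resolve_right hvb
  have h1 : g 1 = 0 := by
    rw [h0, zero_smul, zero_add] at hg'
    exact (smul_eq_zero.mp hg').resolve_right hu0
  intro i
  fin_cases i
  · exact h0
  · exact h1

/-- **`dim (W ∩ {u_j = 0}) ≤ 1` ⇒ some pair `(j, b′)`, `b′ ≠ j`, separates `W`.** OURS (linear algebra:
otherwise two independent vectors in `W ∩ {u_j = 0}`). [folklore] -/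
theorem exists_separating_snd_of_finrank_inf_le_one {W : Submodule K (Fin 4 → K)} (j : Fin 4)
    (h : Module.finrank K ↥(W ⊓ boundarySubspace K {j}) ≤ 1) :
    ∃ b' : Fin 4, j ≠ b' ∧ ∀ u ∈ W, u j = 0 → u b' = 0 → u = 0 := by
  classical
  by_cases hker : ∀ v ∈ W, v j = 0 → v = 0
  · refine ⟨j + 1, ?_, fun u hu huj _ => hker u hu huj⟩
    intro hj
    have := congrArg Fin.val hj
    simp [Fin.val_add] at this
    omega
  push Not at hker
  obtain ⟨v, hv, hvj, hv0⟩ := hker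
  obtain ⟨b', hvb⟩ : ∃ b', v b' ≠ 0 := by
    by_contra hc
    push Not at hc
    exact hv0 (funext hc)
  have hjb : j ≠ b' := fun hj => hvb (hj ▸ hvj)
  refine ⟨b', hjb, fun u hu huj hub => ?_⟩
  by_contra hu0
  have hvW : v ∈ W ⊓ boundarySubspace K {j} :=
    Submodule.mem_inf.mpr ⟨hv, fun i hi => by rw [Finset.mem_singleton.mp hi]; exact hvj⟩
  have huW : u ∈ W ⊓ boundarySubspace K {j} :=
    Submodule.mem_inf.mpr ⟨hu, fun i hi => by rw [Finset.mem_singleton.mp hi]; exact huj⟩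
  have hli := linearIndependent_pair_of_apply hvW huW hvb hub hu0
  have h2 := hli.fintype_card_le_finrank
  simp only [Fintype.card_fin] at h2
  omega

/-- **Every successor of an `ē ≤ 2` floor state is planar in a pair containing the chart coordinate.**
On a `Step0`-type edge (order `p`, `∇(in F) ≠ 0`, `(j,b)` equimultiple) from a state with `ē(s) ≤ 2`:
there is `b′ ≠ j` with `𝔪₀ ≤ (x_j, x_{b′}) + J_p⁺(s⁺.F) + 𝔪₀²` (the successor's ridge meets `{u_j = 0}` in
dimension `≤ ē(s) − 1 ≤ 1`, p-5 g2's `finrank_additiveSubspace_step_inf_add_one_le`; then §2 and wide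
apolarity). OURS (glue). [cite: CossartJannsenSaito2020, Thm. 9.4] -/
theorem exists_originIdeal_le_span_pair_sup_step [DecidableEq K] (p : ℕ) [Fact p.Prime] [CharP K p]
    {s : State K} (hord : ordZero s.F = p) (hgrad : gradSpan (initialForm s.F) ≠ ⊥) {j : Fin 4}
    {b : Fin 4 → K} (hbj : b j = 0) (heq : CentreBlowup.IsEquimultiplePoint p Finset.univ j b s)
    (he : ebar s.F ≤ 2) :
    ∃ b' : Fin 4, j ≠ b' ∧ originIdeal K ≤
      Ideal.span {(X j : MvPolynomial (Fin 4) K), X b'} ⊔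
        singLocusIdeal p (CentreBlowup.step p Finset.univ j b s).F ⊔ originIdeal K ^ 2 := by
  have hp2 : 2 ≤ p := (Fact.out : p.Prime).two_le
  have hord' : ordZero (CentreBlowup.step p Finset.univ j b s).F = p :=
    Directrix.ordZero_step_eq p hord hgrad hbj heq
  have hdim := WideSuccessorRidge.finrank_additiveSubspace_step_inf_add_one_le p hord hgrad hbj heq
  obtain ⟨b', hjb, hsep⟩ := exists_separating_snd_of_finrank_inf_le_one
    (W := additiveSubspace (initialForm (CentreBlowup.step p Finset.univ j b s).F)) j (by omega)
  exact ⟨b', hjb, originIdeal_le_span_pair_sup hp2 hord' hsep⟩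

/-! ## §3 The laws (NT)(i), (NT)(ii), and the level-2 certificate corollary -/

/-- **(NT)(i), closed.** On a `Step0`-type edge (order `p`, `∇ ≠ 0`, `(j,b)` equimultiple): if some
`g ∈ J_p⁺(s.F) + 𝔪₀ᴹ` (`M ≥ 3`) with all monomials of degree `≥ 2` has its quadratic part non-zero at the
direction `w = e_j + b` (a NON-TANGENT move at fat-point order `2`), then `ē(s⁺) < ē(s)` — a wide state
with `o = 2` has no wide successor in a non-tangent direction. OURS (§1 ∘ p-5 g2's
`WideSuccessorRidge.ebar_step_lt_of_aeval_eq_X_sq_mul`). [cite: CossartJannsenSaito2020, Thm. 9.4] -/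
theorem ebar_step_lt_of_eval_ne_zero [DecidableEq K] (p : ℕ) [Fact p.Prime] [CharP K p] {s : State K}
    (hord : ordZero s.F = p) (hgrad : gradSpan (initialForm s.F) ≠ ⊥) {j : Fin 4} {b : Fin 4 → K}
    (hbj : b j = 0) (heq : CentreBlowup.IsEquimultiplePoint p Finset.univ j b s)
    {g : MvPolynomial (Fin 4) K} {M : ℕ} (hM : 3 ≤ M)
    (hg : g ∈ singLocusIdeal p s.F ⊔ originIdeal K ^ M) (hg2 : ∀ A ∈ g.support, 2 ≤ A.degree)
    (hw : eval (Function.update b j 1) (homogeneousComponent 2 g) ≠ 0) :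
    ebar (CentreBlowup.step p Finset.univ j b s).F < ebar s.F :=
  WideSuccessorRidge.ebar_step_lt_of_aeval_eq_X_sq_mul p hord hgrad hbj heq hM hg
    (aeval_chart_eq_X_pow_mul j b hg2) (by rw [constantCoeff_chartQuotient j b hg2]; exact hw)

/-- **(NT)(ii), closed.** On a `Step0`-type edge from a state with `ē(s) ≤ 2`: if some
`g ∈ J_p⁺(s.F) + 𝔪₀ᴹ` with all monomials of degree `≥ o ≥ 1` (`o + 1 ≤ M`) has its degree-`o` part
non-zero at the direction, then `d_k(s⁺) = jetColength p k s⁺.F < k(k+1)/2` for every `k ≥ o`: the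
successor's order letter is `≤ o − 1` (`x_j^{o−1} ∈ J_p⁺(s⁺.F) + 𝔪₀^o` is a plane relation of degree
`< o` in a residual pair `(x_j, x_{b′})` of `s⁺`). OURS (§1–§2 ∘ p-5 g2's `X_pow_pred_mem_of_aeval_eq_mul_unit`
∘ `finrank_lt_triangle_of_X_pow_mem`). [cite: CossartJannsenSaito2020, Thm. 9.4] -/
theorem jetColength_step_lt_triangle_of_eval_ne_zero [DecidableEq K] (p : ℕ) [Fact p.Prime]
    [CharP K p] {s : State K} (hord : ordZero s.F = p) (hgrad : gradSpan (initialForm s.F) ≠ ⊥)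
    {j : Fin 4} {b : Fin 4 → K} (hbj : b j = 0)
    (heq : CentreBlowup.IsEquimultiplePoint p Finset.univ j b s) (he : ebar s.F ≤ 2)
    {g : MvPolynomial (Fin 4) K} {o M : ℕ} (ho : 1 ≤ o) (hoM : o + 1 ≤ M)
    (hg : g ∈ singLocusIdeal p s.F ⊔ originIdeal K ^ M) (hgo : ∀ A ∈ g.support, o ≤ A.degree)
    (hw : eval (Function.update b j 1) (homogeneousComponent o g) ≠ 0) {k : ℕ} (hk : o ≤ k) :
    jetColength p k (CentreBlowup.step p Finset.univ j b s).F < k * (k + 1) / 2 := by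
  have hordA : (p : ℕ∞) ≤ CentreBlowup.ordAlong Finset.univ s.F :=
    Directrix.le_ordAlong_univ_of_ordZero_eq hord
  -- `x_j^{o-1} ∈ J⁺(s⁺) + 𝔪₀^{M-1}`, hence at level `o`
  have hx := ExceptionalLength.X_pow_pred_mem_of_aeval_eq_mul_unit p s j b hbj hordA ho hg
    (aeval_chart_eq_X_pow_mul j b hgo) (by rw [constantCoeff_chartQuotient j b hgo]; exact hw)
  have hle : singLocusIdeal p (CentreBlowup.step p Finset.univ j b s).F ⊔ originIdeal K ^ (M - 1) ≤
      singLocusIdeal p (CentreBlowup.step p Finset.univ j b s).F ⊔ originIdeal K ^ o :=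
    sup_le_sup_left (Ideal.pow_le_pow_right (by omega)) _
  have hxo : (X j : MvPolynomial (Fin 4) K) ^ (o - 1) ∈
      singLocusIdeal p (CentreBlowup.step p Finset.univ j b s).F ⊔ originIdeal K ^ o := hle hx
  -- a residual pair `(x_j, x_{b'})` of the successor
  obtain ⟨b', hjb, hm⟩ := exists_originIdeal_le_span_pair_sup_step p hord hgrad hbj heq he
  exact jetColength_lt_triangle_of_X_pow_mem hjb hm (by omega) hxo hk

/-- **Level-2 certificate kills width.** If `𝔪₀² ≤ J_p⁺(s.F) + 𝔪₀³` (`IsCert p 2 s.F`: `μ⁺ = d₂`; for a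
wide state `μ⁺ = 3`, the fat point is `Spec K[u,v]/(u,v)²`), then EVERY `Step0`-type move from `s`
drops the ridge dimension: `x_j² ∈ 𝔪₀² ≤ J⁺ + 𝔪₀³` pulls back to `x_j² · 1`.  Hence every state of an
infinite wide (`E2`) chain has `μ⁺ ≥ 4`. OURS (corollary). [cite: CossartJannsenSaito2020, Thm. 9.4] -/
theorem ebar_step_lt_of_isCert_two [DecidableEq K] (p : ℕ) [Fact p.Prime] [CharP K p] {s : State K}
    (hord : ordZero s.F = p) (hgrad : gradSpan (initialForm s.F) ≠ ⊥) {j : Fin 4} {b : Fin 4 → K}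
    (hbj : b j = 0) (heq : CentreBlowup.IsEquimultiplePoint p Finset.univ j b s)
    (hc : IsCert p 2 s.F) :
    ebar (CentreBlowup.step p Finset.univ j b s).F < ebar s.F := by
  classical
  have hX2 : (X j : MvPolynomial (Fin 4) K) ^ 2 ∈ singLocusIdeal p s.F ⊔ originIdeal K ^ 3 :=
    hc (Ideal.pow_mem_pow (IsolatedScope.X_mem_originIdeal j) 2)
  refine ebar_step_lt_of_eval_ne_zero p hord hgrad hbj heq le_rfl hX2 (fun A hA => ?_) ?_
  · rw [X_pow_eq_monomial, support_monomial, if_neg one_ne_zero, Finset.mem_singleton] at hA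
    rw [hA, Finsupp.degree_single]
  · have hmem : monomial (Finsupp.single j 2) (1 : K) ∈ homogeneousSubmodule (Fin 4) K 2 :=
      (mem_homogeneousSubmodule 2 _).mpr (isHomogeneous_monomial _ (by rw [Finsupp.degree_single]))
    rw [X_pow_eq_monomial, homogeneousComponent_of_mem hmem, if_pos rfl, eval_monomial,
      Finsupp.prod_single_index (h := fun n e => Function.update b j 1 n ^ e) (pow_zero _)]
    simp only [Function.update_self, one_pow, mul_one]
    exact one_ne_zero

/-- `μ⁺`-reading of the corollary: a state whose colength sequence is already stationary at level `2`
(`jetColength p 2 s.F = jetColength p 3 s.F`) loses ridge dimension at every move. OURS (corollary).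
[cite: AtiyahMacdonald1969, Prop. 6.9 (length is additive)] -/
theorem ebar_step_lt_of_jetColength_two_eq_three_level [DecidableEq K] (p : ℕ) [Fact p.Prime]
    [CharP K p] {s : State K} (hord : ordZero s.F = p) (hgrad : gradSpan (initialForm s.F) ≠ ⊥)
    {j : Fin 4} {b : Fin 4 → K} (hbj : b j = 0)
    (heq : CentreBlowup.IsEquimultiplePoint p Finset.univ j b s)
    (h23 : jetColength p 3 s.F = jetColength p 2 s.F) :
    ebar (CentreBlowup.step p Finset.univ j b s).F < ebar s.F :=
  ebar_step_lt_of_isCert_two p hord hgrad hbj heq (certificate_of_finrank_eq h23)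

end Summit.ResolutionOfSingularities.ResolutionOfSingularities.Theorems.PIDim4.RidgeBudget

end
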